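import Literature.Computability.QuantumComplexity.Sampling
import HarnessLib
import HarnessLib.Audit

/-!
# Approximate BosonSampling: the Aaronson–Arkhipov hardness chain (AA13 Thm. 1.3 under PGC)

Family `quantum-advantage`; companion to `Sampling.lean` (statement **quantum-advantage.S21**,
`PSharpP_subset_BPPRelClass_NP_of_approxBosonSampling`). Source: S. Aaronson, A. Arkhipov, *The
computational complexity of linear optics*, Theory of Computing 9 (2013) 143–252 (cited as AA13
with the journal's numbering and pagination: Problem 1.2 and Thm. 1.3 p. 152, Conj. 1.5 p. 153,
Fig. 2 p. 154, Thm. 1.1 p. 149, Def. 2.3/2.4 pp. 162–163, eq. (2.1) p. 162, Def. 3.11 p. 174,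
Thm. 4.1 p. 175, proof of Thm. 1.3 §5.2 pp. 192–195, Cor. 5.9 p. 195, §5.3 p. 196), together with
the classical fact its Fig. 2 chain uses silently: an oracle computable in `FP^A` can be replaced
by its computation (Arora–Barak 2009, §3.4, Example 3.6 (2) with Remark 3.8).

This file

* records why S21 as vendored is **mis-stated** — its hypotheses differ from the printed ones in
  three independent respects (below), the first two making it stronger than anything printed in
  AA13 — and vendors the corrected statement
  `PSharpP_subset_BPPRelClass_NP_of_uniformApproxBosonSampling` (AA13 Fig. 2 / §5.3: Thm. 1.3 +
  Cor. 5.9 + Conj. 1.5 give `P^{#P} ⊆ BPP^{NP}`);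
* defines the objects the printed chain is about, in the tree's oracle model: *coin-taking* GPE
  oracles (`GPERandOracleEstimate`, `GPERandOracleSolves`; AA13's convention that a randomised
  oracle "takes as input a random string `r`, which it uses as its only source of randomness",
  Thm. 1.1, Def. 3.11, Thm. 2.5 (i)), the Permanent-of-Gaussians Conjecture for such oracles
  (`PermanentOfGaussiansConjectureRand`, Conj. 1.5 in the `|GPE|²_±` form of Problem 1.2),
  "`|GPE|²_± ∈ FBPP^C`" (`GPESolvableInFBPPRel C`), approximate BosonSampling samplers in the
  sense of Def. 3.11 (`IsApproxBosonSampler`) and the uniform sampling hypothesis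
  (`UniformApproxBosonSampling`, "BosonSampling `∈ SampP`", Def. 2.3);
* vendors the two ingredients of the printed chain as named facts —
  `gpeSolvableInFBPPRel_NP_of_uniformApproxBosonSampling` (AA13 Thm. 1.3 with Cor. 5.9) and
  `PRel_subset_PRel_of_mem_FPRel` (`f ∈ FP^O ⟹ P^f ⊆ P^O`, Arora–Barak Example 3.6 (2),
  relativised, for function oracles);
* and **proves** the assembly exactly as in Fig. 2 / §5.3:
  `PSharpP_subset_BPPRelClass_of_gpeSolvableInFBPPRel` (PGC + `|GPE|²_± ∈ FBPP^C` ⟹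
  `P^{#P} ⊆ BPP^C`, for any class `C`, covering also the `SampP^{PH}`/`FBPP^{PH}` variant of
  Cor. 5.9) and `PSharpP_subset_BPPRelClass_NP_of_uniformApproxBosonSampling_of_facts`.

## Why S21 is mis-stated

S21 reads `PermanentOfGaussiansConjecture → (∃ A, IsPPT A id ∧ ∀ x k, 0 < k →
‖A.samplePMF x k − bosonSamplingProblem x‖ ≤ 1/k) → PSharpP ⊆ BPPRelClass NP`. AA13's numbered
results are Thm. 1.3 (`|GPE|²_± ∈ FBPP^{NP^O}` for every approximate BosonSampling oracle `O`)
and Cor. 5.9 (BosonSampling `∈ SampP ⟹ |GPE|²_± ∈ FBPP^{NP}`); the collapse `P^{#P} = BPP^{NP}`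
under PGC is the chain of Fig. 2 (p. 154) and §5.3 (p. 196: "if `|GPE|²_±` is `#P`-hard, then
`FBPP` cannot equal `FBQP` unless `P^{#P} = BPP^{NP}`"). Hypotheses (1) and (2) of S21 are
*weaker* than the printed ones they stand for and (3) does not cover the printed one (it is
incomparable with it), so S21 is not the printed statement and asserts more than the source:

1. **The form of PGC (coins of the GPE oracle).** S19's `PermanentOfGaussiansConjecture`
   quantifies over *coinless* oracles `O : List Bool → List Bool` whose guarantee is a
   probability over `X` alone. AA13's oracles take their random string as part of the query,
   fixed by the reduction (Thm. 1.1: "the `BPP^{NP}` machine gets to fix the random bits used by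
   `O`"; Def. 3.11; Thm. 2.5 (i)), and the `|GPE|²_±`-solver delivered by the proof of Thm. 1.3 is
   randomised with a guarantee *jointly* over `X` and its internal coins (eqs. (5.96)–(5.97):
   "the probabilities are over `X` and `A` as well as the internal randomness"). Fig. 2's step
   "assuming PGC, `|GPE|²_± ∈ BPP^{NP}` gives `P^{#P} = BPP^{NP}`" therefore uses PGC for
   coin-taking oracles (`PermanentOfGaussiansConjectureRand` below), of which the coinless S19 is
   the special case (`gpeRandOracleSolves_ignoreCoins`). S21's docstring appeals to "standard
   amplification", which lowers the failure probability over the coins but does not remove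
   them. Feeding the randomised `FBPP^{NP}` solver to the coinless S19 needs an argument that is
   not in print: either a pseudo-deterministic solver (one canonical answer per query with high
   probability), or — after fixing the solver's coins independently for each query, which gives
   a coinless oracle solving `|GPE|²_±` with high probability over the fixing — a way to make
   S19's reduction machine, which may depend on the oracle, independent of it (e.g. a program
   checker for the permanent); fixing one coin string per input length instead gives advice,
   `P^{#P} ⊆ BPP^{NP}/poly`.
2. **Uniformity of the sampler.** `IsPPT A id` (= `RandAlg.IsPolyTime`) only bounds the coin
   budget `A.coinLen ≤ poly`; `RandAlg.outputPMF` feeds exactly `coinLen |x|` coins and `A.run`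
   may read `|r|`, so S21's sampler receives the possibly non-computable number `coinLen |x|`,
   i.e. `O(log |x|)` bits of advice. AA13's `SampP` (Def. 2.3) is uniform, and Stockmeyer counting
   (Thm. 4.1) is applied to the sampler *as a uniform machine*; with advice the printed proof
   yields only `|GPE|²_± ∈ FBPP^{NP}/log` (removing the advice would again need an argument not
   in AA13, e.g. a checker). As for `BPP` (`mem_BPP_iff_randAlg`) and for S22
   (`UniformIQPMultiplicativeSimulation`), the corrected hypothesis adds the exact-polynomial
   coin budget `∃ q, ∀ n, A.coinLen n = q.eval n`.
3. **The instance family.** S21 constrains the sampler only on the tree's `bosonSamplingProblem`,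
   whose non-junk instances are *exactly* column-orthonormal matrices with *dyadic* entries
   (`Sampling.lean`, module docstring). AA13's approximate BosonSampling oracle (Def. 3.11) must be
   `ε`-close to `𝒟_A` "for all `A ∈ 𝒰_{m,n}`", `A` being given to polynomially many bits (§2,
   p. 161: "the entries of `A` are rounded to `p(n)` bits of precision"), and the proof of
   Thm. 1.3 feeds the oracle Haar-random `A` (Lemma 5.8), which are almost surely not dyadic. As
   `Sampling.lean` itself records, transferring the proof to the exact-dyadic sub-family needs an
   exact dyadic orthonormal-approximation step that is not in print (and the sub-family is thin
   in low dimension: by Jacobi's four-square formula `r₄(4^b) = 8 · (1 + 2) = 24`, so for every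
   precision `b ≥ 1` the exactly dyadic unit vectors of `ℂ²` are the same 24 vectors with
   coordinates in `{0, ±1, ±i, (±1 ± i)/2}`, and `𝒰_{2,1}`, `𝒰_{2,2}` have finitely many
   exact-dyadic points in all precisions together). The corrected hypothesis
   `IsApproxBosonSampler` is Def. 3.11 in the tree's input format: closeness to `𝒟_U` on the
   `b`-bit rounding of *every* column-orthonormal `U`, for all `b` above a polynomial precision
   threshold.

The corrected statement replaces the three hypotheses by the printed ones; its two unproved
ingredients are AA13 Thm. 1.3/Cor. 5.9 and the folklore composition `P^{FP^O} ⊆ P^O`.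

## Design choices

* **Joint probabilities over `X` and coins** are written as the average over the `2^m` coin
  strings of the Gaussian probability of the `r`-section (`(∑_r μ.real {X | …}) / 2^m`), which is
  the product-measure probability by Fubini for a finite second factor; this avoids a product
  `Measure` on `Matrix × List.Vector`.
* **Coins as padding.** A coin-taking GPE oracle is queried on `boolPair q r` with
  `q = encodeGPEQuery ⟨n, b, k_ε, k_δ, X̃⟩` (accuracy parameters in *binary*, as in Q6) and
  `|r| = c (n + k_ε + k_δ)` for a polynomial `c` chosen by the oracle. Since `|r|` is polynomial
  in `k_ε + k_δ`, an `FP^{NP}` machine answering such queries may run in time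
  `poly(n, 1/ε, 1/δ)`, exactly AA13's input convention `⟨X, 0^{1/ε}, 0^{1/δ}⟩` (Problem 1.2,
  Def. 2.4): the coin block doubles as the unary padding.
* **Targets on strings.** `bosonTargetPMF U` is `𝒟_U` (Q6 `bosonSamplingPMF`, ordered mode
  assignments with weights `|Per(U_s)|²/n!`) pushed forward along `encodeBosonOutcome`, with the
  junk value `PMF.pure []` when there are no modes (`m = 0`, where `bosonSamplingPMF` has no
  meaning). Ordered assignments refine AA13's occupation-number outcomes `Φ_{m,n}` (forgetting
  the order is a push-forward, which contracts total variation), so a sampler for the refined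
  target is one for AA13's: the hypothesis is at least as strong as the printed one.
* **Precision threshold.** `IsApproxBosonSampler` asks closeness `≤ 1/k` on the `b`-bit rounding
  of `U` for all `b ≥ p₀ (n + e + k)`, `p₀` a polynomial chosen by the sampler (AA13 §2: "there
  exists a fixed polynomial `p` such that none of the relevant calculations are affected by
  precision issues"). Some threshold is necessary for satisfiability (two orthonormal `U, U'`
  with far-apart `𝒟_U, 𝒟_{U'}` have the same coarse rounding); above it the hypothesis is
  satisfiable by an (inefficient) sampler because `U ↦ 𝒟_U` is Lipschitz in the entries:
  `|Per(U_s) − Per(U'_s)| = O(n · n! · 2^{-b})` for entries bounded by `1`, over at most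
  `(n+e)^n` outcomes.
* **The tree's `P^{#P} ⊆ BPP^{O}` for long-answer oracles.** As for S19, the quantifier in
  `PermanentOfGaussiansConjectureRand` ranges over all `O : Oracle`; see `Sampling.lean` (module
  docstring, "Oracles with long answers") for why this agrees with the polynomially bounded
  reading.
* Everything is stated with the tree's fixed classes (`PSharpP`, `BPPRel`, `BPPRelClass`, `NP`,
  `FPRel`) and Q6's GPE query interface (`encodeGPEQuery`, `roundMatrix`, `GPEOracleEstimate`'s
  decoding convention: malformed answers decode to `0`).

## What a discharge of the Thm. 1.3 fact would need (not vendored here)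

AA13's proof of Thm. 1.3 (§5.2, pp. 192–195) combines: Stockmeyer approximate counting in
`FBPP^{NP^f}` (Thm. 4.1, p. 175); the Haar-unitary hiding theorem `p_S(X) ≤ (1 + O(δ)) p_G(X)`
for `m ≥ (n⁵/δ) log²(n/δ)` (Thms. 5.1–5.2, p. 183; companion file `HaarUnitaryHiding.lean`);
rejection sampling (Lemma 5.7, p. 190; companion file `RejectionSampling.lean`); the Hiding
Lemma in `BPP^{NP}` via `PostBPP ⊆ BPP^{NP}` (Lemma 5.8, p. 191, with eq. (2.1), p. 162,
Han–Hemaspaandra–Thierauf); and the symmetry/Markov accounting (5.82)–(5.97). Beyond the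
missing infrastructure (approximate counting relative to an oracle, `PostBPP ⊆ BPP^{NP}`), the
printed hiding procedure samples `A ∼ ℋ_{m,n}` "in `BPP`" by Gram–Schmidt on Gaussians and
*postselects* on the event that `X/√m` occurs as a submatrix of `A` (p. 192) — an event of
probability zero for real-valued `A`, meaningful only after the rounding to `p(n)` bits that §2
(p. 161) leaves implicit; a discharge has to supply this finite-precision sampler and its error
accounting, which is not a transcription of the printed proof.
-/

open MeasureTheory Matrix Computability Literature.Computability.Complexity Literature.Computability.Complexity.Nondeterministic Literature.Computability.Cryptography

namespace Literature.Computability.QuantumComplexity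

/-! ### Coin-taking GPE oracles (AA13's randomised-oracle convention) -/

/-- `GPERandOracleEstimate O n b kε kδ X̃ r`: the integer answer of the oracle `O` on the GPE query
`⟨n, b, kε, kδ, X̃⟩` *together with the coin string `r`*, i.e. on `boolPair (encodeGPEQuery …) r`,
decoded with `encodingIntBool` (malformed answers decode to `0`, as in `GPEOracleEstimate`). This
is AA13's convention for randomised oracles: the oracle "takes as input a random string `r`,
which it uses as its only source of randomness", and the querying machine chooses `r`
(AA13 Thm. 1.1, p. 149; Def. 3.11, p. 174; Thm. 2.5 (i), p. 163). [cite: AaronsonArkhipovToC2013, Thm. 1.1 (p. 149) and Def. 3.11 (p. 174)] -/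
def GPERandOracleEstimate (O : Oracle) (n b kε kδ : ℕ) (X : Matrix (Fin n) (Fin n) (ℤ × ℤ))
    (r : List Bool) : ℤ :=
  (encodingIntBool.decode (O (boolPair (encodeGPEQuery ⟨n, b, kε, kδ, X⟩) r))).getD 0

/-- `GPERandOracleSolves O`: the coin-taking oracle `O` solves `|GPE|²_±` (AA13 Problem 1.2) in
the sense a randomised algorithm does: there are polynomials `p` (precision) and `c` (number of
coins) such that for all `n` and all `k_ε, k_δ ≥ 1` (`ε = 1/k_ε`, `δ = 1/k_δ`), with
`b = p (n + k_ε + k_δ)` and `m = c (n + k_ε + k_δ)`, the answer `z` on the rounded matrix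
`X̃ = roundMatrix b X` and coins `r ∈ {0,1}^m`, read as `z / 4^b`, satisfies
`|z/4^b − |Per X|²| ≤ ε · n!` except with probability `< δ` *jointly* over
`X ∼ 𝒩(0,1)_ℂ^{n×n}` and uniform `r` — written as the average over `r` of the Gaussian
probability of the `r`-section (Fubini). This is the guarantee established for the solver in the
proof of Thm. 1.3 ("the probabilities are over `X` and `A` as well as the internal randomness",
eqs. (5.96)–(5.97), p. 195: total failure probability `< δ`), and `GPEOracleSolves` is its
coinless special case (`gpeRandOracleSolves_ignoreCoins`). The coin block also serves as the
unary padding `0^{1/ε}, 0^{1/δ}` of Problem 1.2 (module docstring).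
[cite: AaronsonArkhipovToC2013, Problem 1.2 (p. 152) with Thm. 1.3 proof eqs. (5.96)–(5.97) (p. 195)] -/
def GPERandOracleSolves (O : Oracle) : Prop :=
  ∃ p c : Polynomial ℕ, ∀ (n kε kδ : ℕ), 0 < kε → 0 < kδ →
    (∑ r : List.Vector Bool (c.eval (n + kε + kδ)),
        (gaussianMatrixMeasure n).real
          {X | (n.factorial : ℝ) / kε <
            |(GPERandOracleEstimate O n (p.eval (n + kε + kδ)) kε kδ
                  (roundMatrix (p.eval (n + kε + kδ)) (Matrix.of X)) r.toList : ℝ) /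
                4 ^ (p.eval (n + kε + kδ)) -
              ‖(Matrix.of X).permanent‖ ^ 2|}) /
      2 ^ (c.eval (n + kε + kδ)) < 1 / (kδ : ℝ)

/-- **The Permanent-of-Gaussians Conjecture for coin-taking oracles** (AA13 Conj. 1.5 in the
`|GPE|²_±` form of Problem 1.2, with AA13's randomised-oracle convention): `|GPE|²_±` is `#P`-hard
under randomised polynomial-time Turing reductions — for every oracle `O` that solves `|GPE|²_±`
when handed its coins as part of the query (`GPERandOracleSolves O`, guarantee jointly over the
Gaussian input and the coins), `P^{#P} ⊆ BPP^{O}` ("if `O` is any oracle that solves `GPE`, then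
`P^{#P} ⊆ BPP^{O}`", Conj. 1.5; "the `BPP` machine gets to fix the random bits used by `O`",
Thm. 1.1). This is the form consumed by AA13's Fig. 2 / §5.3 chain ("if `|GPE|²_±` is `#P`-hard
… unless `P^{#P} = BPP^{NP}`", p. 196), because the solver produced by Thm. 1.3 is randomised.
AA13 state Conj. 1.5 for the multiplicative variant `GPE_×`, equivalent to `|GPE|²_±` under PACC
(Thm. 1.7); as in S19 the `|GPE|²_±` form is used. S19 (`PermanentOfGaussiansConjecture`) is the
restriction to coinless oracles. Open conjecture: stated as a `Prop`.
[cite: AaronsonArkhipovToC2013, Conj. 1.5 (p. 153) with Problem 1.2 (p. 152), Thm. 1.1 (p. 149) and §5.3 (p. 196)] -/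
@[conjecture] def PermanentOfGaussiansConjectureRand : Prop :=
  ∀ O : Oracle, GPERandOracleSolves O → PSharpP ⊆ BPPRel O

/-- `GPESolvableInFBPPRel C`: "`|GPE|²_± ∈ FBPP^{C}`" in the tree's model — for some language
`L ∈ C` there is a deterministic polynomial-time oracle transducer with oracle `L`
(`O ∈ FPRel (Oracle.ofLanguage L)`) which, run on GPE queries with its coins appended
(`boolPair q r`), solves `|GPE|²_±` jointly over the Gaussian input and the coins
(`GPERandOracleSolves O`). A randomised `FBPP^{L}` machine is exactly such a deterministic
`FP^{L}` machine reading its coins from the input (AA13 Thm. 1.1, p. 149: "we can always interpret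
a randomized algorithm as just a deterministic algorithm that takes a random string `r` as part of
its input"; Def. 2.4, `FBPP`). [cite: AaronsonArkhipovToC2013, Def. 2.4 (p. 163) with Thm. 1.1 (p. 149)] -/
def GPESolvableInFBPPRel (C : Set (Language Bool)) : Prop :=
  ∃ L ∈ C, ∃ O ∈ FPRel (Oracle.ofLanguage L), GPERandOracleSolves O

/-- `|GPE|²_± ∈ FBPP^{C}` is monotone in the oracle class. [folklore] -/
theorem GPESolvableInFBPPRel.mono {C D : Set (Language Bool)} (hCD : C ⊆ D)
    (h : GPESolvableInFBPPRel C) : GPESolvableInFBPPRel D := by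
  obtain ⟨L, hL, O, hO, hs⟩ := h
  exact ⟨L, hCD hL, O, hO, hs⟩

/-! ### Approximate BosonSampling samplers (AA13 Def. 3.11) -/

/-- Entrywise rounding of a rectangular complex matrix to precision `b` (pairs of nearest
integers to `2^b · re`, `2^b · im`, Q6 `roundDyadic`), in the input format of
`encodingBosonInput`. (AA13 §2, p. 161: "the entries of `A` are rounded to `p(n)` bits of
precision".) [cite: AaronsonArkhipovToC2013, §2 (p. 161)] -/
noncomputable def roundEntries {m n : ℕ} (b : ℕ) (U : Matrix (Fin m) (Fin n) ℂ) :
    Fin m → Fin n → ℤ × ℤ :=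
  fun i j => roundDyadic b (U i j)

/-- The BosonSampling target of a complex `m × n` matrix `U` as a distribution on strings:
`𝒟_U` (`bosonSamplingPMF U`, weights `|Per(U_s)|²/n!` on ordered mode assignments
`s : Fin n → Fin m`) pushed forward along `encodeBosonOutcome`; junk value `PMF.pure []` when
`m = 0` (no modes). (AA13 §1.1, eq. (1.3); restated as eq. (5.77) in §5.2.) [cite: AaronsonArkhipovToC2013, §5.2 eq. (5.77) (p. 192)] -/
noncomputable def bosonTargetPMF {m n : ℕ} (U : Matrix (Fin m) (Fin n) ℂ) : PMF (List Bool) :=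
  if h : m = 0 then PMF.pure []
  else
    haveI : NeZero m := ⟨h⟩
    (bosonSamplingPMF U).map encodeBosonOutcome

/-- `IsApproxBosonSampler A`: the classical sampler `A` is an **approximate BosonSampling
oracle** in the sense of AA13 Def. 3.11 — "‖𝒟_O(A, ε) − 𝒟_A‖ ≤ ε for all `A ∈ 𝒰_{m,n}` and
`ε > 0`", the matrix being given to polynomially many bits (§2). Formally: there is a polynomial
precision threshold `p₀` such that for every column-orthonormal `U ∈ 𝒰_{n+e,n}`, every accuracy
`k ≥ 1` and every precision `b ≥ p₀ (n + e + k)`, on input `⟨⟨n, e, b, round_b U⟩, 1^k⟩` the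
output distribution of `A` is within total variation distance `1/k` of `𝒟_U`
(`bosonTargetPMF U`). See the module docstring for the threshold and for ordered outcomes.
[cite: AaronsonArkhipovToC2013, Def. 3.11 (p. 174) with §2 (p. 161)] -/
def IsApproxBosonSampler (A : RandAlg (List Bool) (List Bool)) : Prop :=
  ∃ p₀ : Polynomial ℕ, ∀ (n e b k : ℕ) (U : Matrix (Fin (n + e)) (Fin n) ℂ),
    IsColumnOrthonormal U → 0 < k → p₀.eval (n + e + k) ≤ b →
      (A.samplePMF (encodingBosonInput.encode ⟨n, e, b, roundEntries b U⟩) k).tvDist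
          (bosonTargetPMF U) ≤ 1 / (k : ℝ)

/-- **The uniform approximate-sampling hypothesis** ("BosonSampling `∈ SampP`", AA13 Def. 2.3
with Def. 3.11): some *uniform* probabilistic polynomial-time algorithm — `IsPPT A id` together
with an exactly polynomial coin budget `A.coinLen = q` (Gill's uniform machine, as in
`mem_BPP_iff_randAlg`; without this conjunct `coinLen |x|` is `O(log)` advice, module docstring)
— is an approximate BosonSampling oracle. Hypothesis of AA13 Cor. 5.9 and of the Fig. 2 chain.
[cite: AaronsonArkhipovToC2013, Def. 2.3 (p. 162) and Cor. 5.9 (p. 195)] -/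
@[conjecture] def UniformApproxBosonSampling : Prop :=
  ∃ A : RandAlg (List Bool) (List Bool),
    IsPPT A id ∧ (∃ q : Polynomial ℕ, ∀ n, A.coinLen n = q.eval n) ∧ IsApproxBosonSampler A

/-! ### The corrected statement -/

/-- **Corrected form of quantum-advantage.S21** (AA13, Thm. 1.3 with Cor. 5.9 and Conj. 1.5; the
chain of Fig. 2, p. 154, and §5.3, p. 196). Assume the Permanent-of-Gaussians Conjecture in the
form AA13's chain uses (`|GPE|²_±` is `#P`-hard under randomised reductions, coin-taking oracles:
`PermanentOfGaussiansConjectureRand`). If BosonSampling is approximately samplable by a uniform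
probabilistic polynomial-time algorithm in the sense of Def. 3.11/Def. 2.3
(`UniformApproxBosonSampling`), then `P^{#P} ⊆ BPP^{NP}` (AA13 write `P^{#P} = BPP^{NP}`; `⊇`
is classical), so the polynomial hierarchy collapses by Toda's theorem.

Discrepancy with `PSharpP_subset_BPPRelClass_NP_of_approxBosonSampling` (S21, same cite): S21's
hypotheses (1), (2) are weaker than the printed ones and (3) does not cover the printed one —
(1) it assumes PGC only for coinless
oracles (S19), whereas the solver produced by Thm. 1.3 is randomised with a joint guarantee over
input and coins, so Fig. 2's step needs PGC for coin-taking oracles; (2) it omits the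
exact-polynomial coin budget, admitting advice-taking samplers, whereas `SampP` (Def. 2.3) is
uniform; (3) it constrains the sampler only on exactly column-orthonormal dyadic instances,
whereas Def. 3.11 constrains it on polynomial-precision descriptions of all `A ∈ 𝒰_{m,n}` and
the proof of Thm. 1.3 feeds Haar-random `A` (S21's constraint at every precision on the thin
exact-dyadic family is incomparable with this). Hence S21 asserts more than the source; see the
module docstring. `PSharpP_subset_BPPRelClass_NP_of_uniformApproxBosonSampling_of_facts` derives
this statement from Thm. 1.3/Cor. 5.9 and `P^{FP^O} ⊆ P^O`, exactly as in Fig. 2.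
[cite: AaronsonArkhipovToC2013, Thm. 1.3 (p. 152) with Cor. 5.9 (p. 195), Conj. 1.5 (p. 153) and Fig. 2 (p. 154)] -/
def PSharpP_subset_BPPRelClass_NP_of_uniformApproxBosonSampling : Prop :=
  PermanentOfGaussiansConjectureRand → UniformApproxBosonSampling → PSharpP ⊆ BPPRelClass NP

/-! ### Ingredients of the printed chain, as named facts -/

/-- **AA13 Theorem 1.3 with Corollary 5.9** (Main Result), tree form. If some uniform
probabilistic polynomial-time algorithm is an approximate BosonSampling oracle (Def. 3.11), then
`|GPE|²_± ∈ FBPP^{NP}`: some deterministic polynomial-time transducer with an `NP`-language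
oracle, reading its coins from the query, estimates `|Per X|²` to within `± ε · n!` except with
probability `< δ` jointly over `X ∼ 𝒩(0,1)_ℂ^{n×n}` and its coins, at precision and coin
length polynomial in `n + 1/ε + 1/δ` (`GPESolvableInFBPPRel NP`). Thm. 1.3 is the black-box
form `|GPE|²_± ∈ FBPP^{NP^𝒞}`; Cor. 5.9 specialises to `𝒞 ∈ SampP`. Printed proof (§5.2): hide
`X/√m` as a uniformly random `n × n` submatrix of a Haar-random `A ∈ 𝒰_{m,n}`
(Lemma 5.8, in `BPP^{NP}` via `PostBPP ⊆ BPP^{NP}`, using the hiding theorem Thm. 5.2 and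
rejection sampling Lemma 5.7), feed `A` to the sampler with `β = εδ/24`, estimate the
probability `q_{S*}` of the planted outcome by Stockmeyer counting over the sampler's coins
(Thm. 4.1, in `FBPP^{NP}`; this is where uniformity of the sampler is used), and bound
`|q̃ − p_{S*}|` by Markov's inequality and the symmetry of `S*` given `A` ((5.82)–(5.97)).
[cite: AaronsonArkhipovToC2013, Thm. 1.3 (p. 152; proof §5.2 pp. 192–195) and Cor. 5.9 (p. 195)] -/
def gpeSolvableInFBPPRel_NP_of_uniformApproxBosonSampling : Prop :=
  UniformApproxBosonSampling → GPESolvableInFBPPRel NP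

/-- **An `FP^O`-computable oracle can be replaced by its computation**: if the string function
`f` is computed by a polynomial-time oracle transducer with oracle `O` (`f ∈ FPRel O`), then
`P^f ⊆ P^O` — answer each query to `f` by running the transducer, forwarding its `O`-queries;
polynomially many rounds of polynomially long queries compose to the same. This is Arora–Barak's
Example 3.6 (2) ("if `O ∈ P` then `P^O = P`: replace each oracle call with the computation of
`O`") relativised to `O` (their remark on relativizing results, §3.4) and for function oracles
(Remark 3.8); the tree's `mem_PRel_of_polyTimeTuringReducible` (also still a named fact) is
the language-oracle case. What a discharge needs in the transcript model of `Oracle.lean`: an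
`OracleAlg` whose step function, given `(x, O-answers so far)`, *replays* the outer machine,
answering each of its `f`-queries by a complete sub-run of the transducer against the next
segment of the `O`-transcript — i.e. TM2 routines splitting the answer list into sub-runs, a
polynomially bounded loop of polynomial-time step functions (the tree has
`PolyTimeComputable.comp_holds` and the clocked `PolyTimeComputable.iterate`, but not this
list bookkeeping), and the fuel/transcript induction identifying `run`/`queries` of the
composite with those of the two machines. It holds for every `O` (time is measured against the
received answers, `Oracle.lean` module docstring): with `q₁, q₂` the polynomials of the two
machines, the composite uses at most `q₁(|x|) · (q₂(q₁(|x|)) + 1) + 1` rounds and queries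
of length `≤ q₂(q₁(|x|))`.
[cite: AroraBarak2009, §3.4 Example 3.6 (2) with Remark 3.8] -/
def PRel_subset_PRel_of_mem_FPRel : Prop :=
  ∀ (O f : Oracle), f ∈ FPRel O → PRel f ⊆ PRel O

/-! ### API and assembly (proved) -/

/-- The coinless oracle `O` viewed as a coin-taking one: on a pair-query `boolPair q r` answer
`O q`, ignoring the coins (`boolUnpair` strips the pairing; other strings are answered through
`boolUnpair`'s junk convention). (AA13 Thm. 1.1, p. 149: a deterministic algorithm is the special
case of one "that takes a random string `r` as part of its input".) [cite: AaronsonArkhipovToC2013, Thm. 1.1 (p. 149)] -/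
def ignoreCoins (O : Oracle) : Oracle :=
  fun q => O (boolUnpair q).1

/-- Ignoring the coins, the coin-taking estimate is the coinless one. [folklore] -/
@[simp] theorem gpeRandOracleEstimate_ignoreCoins (O : Oracle) (n b kε kδ : ℕ)
    (X : Matrix (Fin n) (Fin n) (ℤ × ℤ)) (r : List Bool) :
    GPERandOracleEstimate (ignoreCoins O) n b kε kδ X r =
      GPEOracleEstimate O n b kε kδ X := by
  simp [GPERandOracleEstimate, GPEOracleEstimate, ignoreCoins]

/-- Averaging a quantity that does not depend on the coin string over the `2^m` coin strings
returns it. [folklore] -/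
theorem sum_const_div_two_pow (m : ℕ) (a : ℝ) :
    (∑ _r : List.Vector Bool m, a) / 2 ^ m = a := by
  rw [Finset.sum_const, Finset.card_univ, card_vector, Fintype.card_bool, nsmul_eq_mul]
  have h : (2 : ℝ) ^ m ≠ 0 := by positivity
  push_cast
  field_simp

/-- **A coinless GPE solver is a coin-taking one** (with the coins ignored): the joint failure
probability over `X` and `r` of `ignoreCoins O` is the failure probability over `X` of `O`.
So `PermanentOfGaussiansConjectureRand` covers every oracle S19's `PermanentOfGaussiansConjecture`
speaks about, up to the pairing wrapper. (AA13 Thm. 1.1, p. 149.) [cite: AaronsonArkhipovToC2013, Thm. 1.1 (p. 149) with Problem 1.2 (p. 152)] -/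
theorem gpeRandOracleSolves_ignoreCoins {O : Oracle} (h : GPEOracleSolves O) :
    GPERandOracleSolves (ignoreCoins O) := by
  obtain ⟨p, hp⟩ := h
  refine ⟨p, 0, fun n kε kδ hε hδ => ?_⟩
  simp only [gpeRandOracleEstimate_ignoreCoins]
  rw [sum_const_div_two_pow]
  exact hp n kε kδ hε hδ

/-- Consequently PGC for coin-taking oracles yields `P^{#P} ⊆ BPP^{O'}` for the coin-ignoring
wrapper `O'` of every coinless GPE solver `O` — the content of S19 up to the wrapper (removing
it, `BPP^{O'} ⊆ BPP^{O}`, is a machine simulation not carried out here).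
(AA13 Conj. 1.5 with Thm. 1.1.) [cite: AaronsonArkhipovToC2013, Conj. 1.5 (p. 153) with Thm. 1.1 (p. 149)] -/
theorem PermanentOfGaussiansConjectureRand.ignoreCoins
    (hPGC : PermanentOfGaussiansConjectureRand) {O : Oracle} (h : GPEOracleSolves O) :
    PSharpP ⊆ BPPRel (ignoreCoins O) :=
  hPGC _ (gpeRandOracleSolves_ignoreCoins h)

/-- `f ∈ FP^O ⟹ BPP^f ⊆ BPP^O`: the composition fact lifted through the (monotone) `BP·`
operator, `BPPRel O = bp (PRel O)`. (Arora–Barak 2009, Example 3.6 (2), relativised; Def. 7.3.) [cite: AroraBarak2009, §3.4 Example 3.6 (2) with Def. 7.3] -/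
theorem BPPRel_subset_BPPRel_of_mem_FPRel (hcomp : PRel_subset_PRel_of_mem_FPRel)
    {O f : Oracle} (hf : f ∈ FPRel O) : BPPRel f ⊆ BPPRel O :=
  bp_mono (hcomp O f hf)

/-- `BPP^L ⊆ BPP^C` for `L ∈ C` (`BPPRelClass C = ⋃_{L ∈ C} BPP^L`). (Arora–Barak 2009, §7 with
§3.4.) [cite: AroraBarak2009, §7 with §3.4] -/
theorem BPPRel_subset_BPPRelClass {C : Set (Language Bool)} {L : Language Bool} (hL : L ∈ C) :
    BPPRel (Oracle.ofLanguage L) ⊆ BPPRelClass C :=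
  fun _ hK => Set.mem_biUnion hL hK

/-- **The Fig. 2 step, for any oracle class.** PGC (coin-taking form) and `|GPE|²_± ∈ FBPP^{C}`
give `P^{#P} ⊆ BPP^{C}`: the `FP^{L}` solver `O` (`L ∈ C`) is a GPE oracle, so
`P^{#P} ⊆ BPP^{O} ⊆ BPP^{L} ⊆ BPP^{C}` (PGC; `P^{FP^L} ⊆ P^L` through `BP·`; union). With
`C = NP` this is "assuming PGC, `|GPE|²_± ∈ BPP^{NP}` gives `P^{#P} = BPP^{NP}`"; with `C = PH`
it serves the `SampP^{PH}` variant of Cor. 5.9. (AA13 Fig. 2, p. 154; §5.3, p. 196.) [cite: AaronsonArkhipovToC2013, Fig. 2 (p. 154) and §5.3 (p. 196)] -/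
theorem PSharpP_subset_BPPRelClass_of_gpeSolvableInFBPPRel
    (hPGC : PermanentOfGaussiansConjectureRand) (hcomp : PRel_subset_PRel_of_mem_FPRel)
    {C : Set (Language Bool)} (h : GPESolvableInFBPPRel C) : PSharpP ⊆ BPPRelClass C := by
  obtain ⟨L, hL, O, hO, hsolves⟩ := h
  calc PSharpP ⊆ BPPRel O := hPGC O hsolves
    _ ⊆ BPPRel (Oracle.ofLanguage L) := BPPRel_subset_BPPRel_of_mem_FPRel hcomp hO
    _ ⊆ BPPRelClass C := BPPRel_subset_BPPRelClass hL

/-- **The corrected S21 from its printed ingredients**: under the uniform approximate-sampling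
hypothesis, Thm. 1.3/Cor. 5.9 (`gpeSolvableInFBPPRel_NP_of_uniformApproxBosonSampling`) gives
`|GPE|²_± ∈ FBPP^{NP}`, and the Fig. 2 step (`PSharpP_subset_BPPRelClass_of_gpeSolvableInFBPPRel`,
using PGC and `P^{FP^O} ⊆ P^O`) gives `P^{#P} ⊆ BPP^{NP}`. (AA13 Fig. 2, p. 154; §5.3, p. 196.) [cite: AaronsonArkhipovToC2013, Fig. 2 (p. 154) with Thm. 1.3, Cor. 5.9 and Conj. 1.5] -/
theorem PSharpP_subset_BPPRelClass_NP_of_uniformApproxBosonSampling_of_facts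
    (hThm : gpeSolvableInFBPPRel_NP_of_uniformApproxBosonSampling)
    (hcomp : PRel_subset_PRel_of_mem_FPRel) :
    PSharpP_subset_BPPRelClass_NP_of_uniformApproxBosonSampling :=
  fun hPGC hSamp => PSharpP_subset_BPPRelClass_of_gpeSolvableInFBPPRel hPGC hcomp (hThm hSamp)

/-- On an instance with at least one mode, `bosonTargetPMF U` is `𝒟_U` pushed forward along the
outcome encoder. (AA13 §5.2, eq. (5.77).) [cite: AaronsonArkhipovToC2013, §5.2 eq. (5.77) (p. 192)] -/
theorem bosonTargetPMF_of_neZero {m n : ℕ} [NeZero m] (U : Matrix (Fin m) (Fin n) ℂ) :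
    bosonTargetPMF U = (bosonSamplingPMF U).map encodeBosonOutcome := by
  rw [bosonTargetPMF, dif_neg (NeZero.ne m)]

/-- With no modes the target is the junk value `PMF.pure []`. [folklore] -/
theorem bosonTargetPMF_of_eq_zero {n : ℕ} (U : Matrix (Fin 0) (Fin n) ℂ) :
    bosonTargetPMF U = PMF.pure [] := by
  rw [bosonTargetPMF, dif_pos rfl]

/-- Rounding a dyadic Gaussian rational at its own precision returns its integer coordinates:
`round_b ((z₁ + z₂ i)/2^b) = (z₁, z₂)`. [folklore] -/
@[simp] theorem roundDyadic_dyadicComplex (b : ℕ) (z : ℤ × ℤ) :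
    roundDyadic b (dyadicComplex b z) = z := by
  have h2 : (2 : ℝ) ^ b ≠ 0 := pow_ne_zero _ two_ne_zero
  have hz : dyadicComplex b z =
      ((((z.1 : ℝ) / 2 ^ b : ℝ) : ℂ) + (((z.2 : ℝ) / 2 ^ b : ℝ) : ℂ) * Complex.I) := by
    simp only [dyadicComplex]
    push_cast
    ring
  have hre : (dyadicComplex b z).re = (z.1 : ℝ) / 2 ^ b := by
    rw [hz]
    simp only [Complex.add_re, Complex.mul_re, Complex.ofReal_re, Complex.ofReal_im,
      Complex.I_re, Complex.I_im, mul_zero, zero_mul, sub_zero, add_zero]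
  have him : (dyadicComplex b z).im = (z.2 : ℝ) / 2 ^ b := by
    rw [hz]
    simp only [Complex.add_im, Complex.mul_im, Complex.ofReal_re, Complex.ofReal_im,
      Complex.I_re, Complex.I_im, mul_one, mul_zero, add_zero, zero_add]
  ext
  · simp only [roundDyadic, hre, mul_div_cancel₀ _ h2, round_intCast]
  · simp only [roundDyadic, him, mul_div_cancel₀ _ h2, round_intCast]

/-- On an exactly dyadic instance the rounding at its own precision returns the given integer
entries, `roundEntries b (bosonMatrix n e b entries) = entries`: the tree's exact-dyadic
instances (`bosonSamplingProblem`) are among the inputs on which an approximate BosonSampling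
oracle is constrained (at their own precision, when it is above the threshold). [folklore] -/
theorem roundEntries_bosonMatrix (n e b : ℕ) (entries : Fin (n + e) → Fin n → ℤ × ℤ) :
    roundEntries b (bosonMatrix n e b entries) = entries := by
  funext i j
  simp [roundEntries, bosonMatrix]

/-- On the tree's exact-dyadic instances of precision above its threshold, an approximate
BosonSampling oracle is `1/k`-close to `bosonSamplingProblem` — the constraint S21's hypothesis
imposes on those instances (S21 imposes it at *every* precision and also on junk inputs, and
nothing on roundings of non-dyadic matrices, so the two sampler hypotheses are incomparable).
With no modes (`n + e = 0`) both sides are the junk value `PMF.pure []`. [folklore] -/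
theorem IsApproxBosonSampler.tvDist_bosonSamplingProblem_le {A : RandAlg (List Bool) (List Bool)}
    (h : IsApproxBosonSampler A) :
    ∃ p₀ : Polynomial ℕ, ∀ (n e b k : ℕ) (entries : Fin (n + e) → Fin n → ℤ × ℤ),
      IsColumnOrthonormal (bosonMatrix n e b entries) → 0 < k → p₀.eval (n + e + k) ≤ b →
        (A.samplePMF (encodingBosonInput.encode ⟨n, e, b, entries⟩) k).tvDist
            (bosonSamplingProblem (encodingBosonInput.encode ⟨n, e, b, entries⟩)) ≤ 1 / (k : ℝ) := by
  obtain ⟨p₀, hp⟩ := h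
  refine ⟨p₀, fun n e b k entries hU hk hb => ?_⟩
  have key := hp n e b k (bosonMatrix n e b entries) hU hk hb
  rw [roundEntries_bosonMatrix] at key
  rw [bosonSamplingProblem_encode]
  rcases Nat.eq_zero_or_pos (n + e) with h0 | hpos
  · rw [bosonSamplingKernel, dif_pos h0]
    rwa [bosonTargetPMF, dif_pos h0] at key
  · haveI : NeZero (n + e) := ⟨hpos.ne'⟩
    rw [bosonSamplingKernel, dif_neg (NeZero.ne (n + e)), if_pos hU]
    rwa [bosonTargetPMF_of_neZero] at key

/-- **Status of `UniformApproxBosonSampling`: a hypothesis, conjecturally false (AA13 §1.2.2,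
pp. 151–152; §5.3, p. 196).** `UniformApproxBosonSampling` ("BosonSampling `∈ SampP`") is not a
result of the source but the *antecedent* of Cor. 5.9 (p. 195: "Suppose BosonSampling `∈ SampP`.
Then `|GPE|²_± ∈ FBPP^{NP}`") and of the Fig. 2 chain; AA13 read the chain contrapositively —
"there exist … approximate sampling problems that are solvable in polynomial time by a boson
computer, but not by a `BPP` machine unless `P^{#P} = BPP^{NP}`" (§1.2.2, granting PGC), "if
`|GPE|²_±` is `#P`-hard, then `FBPP` cannot equal `FBQP` unless `P^{#P} = BPP^{NP}`" (§5.3). This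
is that contrapositive in the tree's terms: given the two vendored ingredients of the chain
(AA13 Thm. 1.3/Cor. 5.9 and `P^{FP^O} ⊆ P^O`), PGC for coin-taking oracles together with
`P^{#P} ⊄ BPP^{NP}` (a consequence of the non-collapse of `PH`, by Toda's theorem) refutes the
uniform approximate-sampling hypothesis. In particular no discharge
`UniformApproxBosonSampling_holds` can exist unless PGC fails or `P^{#P} ⊆ BPP^{NP}`; whether
`UniformApproxBosonSampling` holds is an open problem.
[cite: AaronsonArkhipovToC2013, §5.3 (p. 196) with Cor. 5.9 (p. 195), Fig. 2 (p. 154) and §1.2.2 (pp. 151–152)] -/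
theorem not_uniformApproxBosonSampling_of_facts
    (hThm : gpeSolvableInFBPPRel_NP_of_uniformApproxBosonSampling)
    (hcomp : PRel_subset_PRel_of_mem_FPRel) (hPGC : PermanentOfGaussiansConjectureRand)
    (hsep : ¬ PSharpP ⊆ BPPRelClass NP) : ¬ UniformApproxBosonSampling :=
  fun hSamp =>
    hsep (PSharpP_subset_BPPRelClass_NP_of_uniformApproxBosonSampling_of_facts hThm hcomp hPGC hSamp)

end Literature.Computability.QuantumComplexity
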